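import Literature.NumberTheory.Irrationality.Zudilin2014.SecondTalePF

/-!
# Zudilin 2014, second tale: the partial-fraction decomposition of `R̂` and `Σ_k B_k = 0` (eq. (T4))

Topic `Literature/NumberTheory/Irrationality/Zudilin2014` [Zudilin2014ZetaTwo, Section 6].  From
`psiPoly_eq_zero` (`SecondTalePF.lean`): for admissible parameters (eq. (cond2)) and `t` off the poles,
[cite: Zudilin2014ZetaTwo, Section 6, display before eq. (T2)]
* `RT_eq_polar_blocks` — `R̂(t) = Σ_{k ∈ [â₂,b̂₂) ∪ [â₃,b̂₃)} (A_k/(t+k)² + B_k/(t+k))`;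
* `RT_eq_polar` — **`R̂(t) = Σ_{k=â₃*}^{b̂₂*−1} A_k/(t+k)² + Σ_{k=â₂*}^{b̂₃*−1} B_k/(t+k)`** (Zudilin's ranges;
  the extra pole-set terms vanish: `A_k = 0` at simple poles and below `â₃*`, `B_k = 0` below `â₂*` — removable
  singularities where the numerator block `(t+b̂₁)⋯(t+â₁−1)` vanishes, `coefAT_eq_zero_of_not_mem`,
  `coefBT_eq_zero_of_not_mem`);
* [cite: Zudilin2014ZetaTwo, Section 6, eq. (T4)] **`sum_coefBT_eq_zero` — `Σ_{k=â₂*}^{b̂₃*−1} B_k = 0`**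
  (the coefficient of `X^{deg denT − 1}` in `Ψ = 0`; analytically the residue of `R̂ = O(t⁻²)` at infinity).
These are the algebraic half of Proposition 3 (`r̂ = q̂ζ(2) − p̂`); the series/integral half is not formalised here.

Cell pub-zeta5 (HONEST FRAMING: systematic search; no irrationality claim unless certified).
-/

noncomputable section

open Polynomial Finset

namespace Literature.NumberTheory.Irrationality.Zudilin2014

variable {a b : Fin 4 → ℤ}

/-! ### The decomposition -/

/-- **Partial fractions of `R̂` over the pole set**: for `t` off the poles,
`R̂(t) = Σ_{k ∈ poles} (A_k/(t+k)² + B_k/(t+k))` (`A_k = 0` at the simple poles).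
[cite: Zudilin2014ZetaTwo, Section 6, display before eq. (T2)] -/
theorem RT_eq_polar_blocks (hab : AdmissibleT a b) {t : ℚ} (ht : (denT a b).eval t ≠ 0) :
    RT a b t = ∑ k ∈ poleSet a b, (coefAT a b k / (t + k) ^ 2 + coefBT a b k / (t + k)) := by
  have hΨ := psiPoly_eq_zero hab
  unfold psiPoly at hΨ
  rw [sub_eq_zero] at hΨ
  unfold RT
  rw [hΨ, eval_finsetSum, sum_div]
  refine sum_congr rfl fun k hk => ?_
  have hμ := one_le_multT_of_mem hk
  have hμ2 := multT_le_two a b k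
  have hfac := denT_eq_dhatT_mul a b k
  have hden : (denT a b).eval t = (dhatT a b k).eval t * (t + k) ^ multT a b k := by
    rw [hfac, eval_mul, eval_pow, eval_add, eval_X, eval_C]
  have hdh : (dhatT a b k).eval t ≠ 0 := by
    intro h; apply ht; rw [hden, h, zero_mul]
  have htk : (t + k) ≠ 0 := by
    intro h; apply ht; rw [hden, h, zero_pow (by omega), mul_zero]
  unfold polarNum
  rw [eval_mul, hden]
  rcases (show multT a b k = 1 ∨ multT a b k = 2 by omega) with h1 | h2
  · rw [h1, coefAT_of_simple h1]
    simp only [Nat.sub_self, pow_zero, mul_one, map_zero, zero_add, eval_C, pow_one, zero_div]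
    field_simp
  · rw [h2]
    simp only [show (2 : ℕ) - 1 = 1 from rfl, pow_one, eval_add, eval_mul, eval_C, eval_X]
    field_simp

/-- `numT(−k) = 0` when the block `(t+b̂₁)⋯(t+â₁−1)` vanishes at `−k`, i.e. `b̂₁ ≤ k < â₁`.
[cite: Zudilin2014ZetaTwo, Section 6 (zeroes of R̂)] -/
theorem eval_numT_eq_zero_of_mem_block1 {k : ℤ} (hk : k ∈ Ico (b 1) (a 1)) :
    (numT a b).eval (-(k : ℚ)) = 0 := by
  unfold numT
  rw [eval_mul, eval_C, eval_mul, eval_block]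
  rw [prod_eq_zero hk (by ring), mul_zero, mul_zero]

/-- Median facts for `â₂*` in linear form (two of `â₁,â₂,â₃` lie on each side).
[cite: Zudilin2014ZetaTwo, Section 6 (ordered parameters)] -/
theorem aMid_spec (a : Fin 4 → ℤ) :
    (a 1 ≤ aMid a ∨ (a 2 ≤ aMid a ∧ a 3 ≤ aMid a)) ∧ (a 2 ≤ aMid a ∨ (a 1 ≤ aMid a ∧ a 3 ≤ aMid a)) ∧
    (a 3 ≤ aMid a ∨ (a 1 ≤ aMid a ∧ a 2 ≤ aMid a)) ∧
    (aMid a ≤ a 1 ∨ (aMid a ≤ a 2 ∧ aMid a ≤ a 3)) ∧ (aMid a ≤ a 2 ∨ (aMid a ≤ a 1 ∧ aMid a ≤ a 3)) ∧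
    (aMid a ≤ a 3 ∨ (aMid a ≤ a 1 ∧ aMid a ≤ a 2)) ∧ (aMid a = a 1 ∨ aMid a = a 2 ∨ aMid a = a 3) := by
  unfold aMid; omega

/-- `A_k = 0` on the pole set outside `[â₃*, b̂₂*)`. [cite: Zudilin2014ZetaTwo, Section 6, eq. (T2)] -/
theorem coefAT_eq_zero_of_not_mem (hab : AdmissibleT a b) {k : ℤ} (hk : k ∈ poleSet a b)
    (hk' : k ∉ Ico (aMax3 a) (bMin b)) : coefAT a b k = 0 := by
  have hμ := one_le_multT_of_mem hk
  have hμ2 := multT_le_two a b k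
  rcases (show multT a b k = 1 ∨ multT a b k = 2 by omega) with h1 | h2
  · exact coefAT_of_simple h1
  · -- double pole below â₃* = â₁: the numerator block 1 vanishes
    have hk2 : k ∈ Ico (a 2) (b 2) ∧ k ∈ Ico (a 3) (b 3) := by
      unfold multT at h2
      by_cases c2 : k ∈ Ico (a 2) (b 2) <;> by_cases c3 : k ∈ Ico (a 3) (b 3) <;> simp [c2, c3] at h2 ⊢
    have hb1 := hab.b1_le 2 (by decide)
    have hblock : k ∈ Ico (b 1) (a 1) := by
      rw [mem_Ico, mem_Ico] at hk2; rw [mem_Ico] at hk' ⊢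
      unfold aMax3 bMin at hk'
      omega
    unfold coefAT
    rw [qpolyT_eq_of_double hk2.1 hk2.2, eval_numT_eq_zero_of_mem_block1 hblock, zero_div]

/-- `B_k = 0` on the pole set outside `[â₂*, b̂₃*)` (removable singularities). [cite: Zudilin2014ZetaTwo, Section 6 (poles of R̂)] -/
theorem coefBT_eq_zero_of_not_mem (hab : AdmissibleT a b) {k : ℤ} (hk : k ∈ poleSet a b)
    (hk' : k ∉ Ico (aMid a) (bMax b)) : coefBT a b k = 0 := by
  have hb1 := hab.b1_le 2 (by decide)
  have hb1' := hab.b1_le 3 (by decide)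
  have ha2 := hab.a_lt 2 (by decide)
  have ha3 := hab.a_lt 3 (by decide)
  have ha1 := hab.a_lt 1 (by decide)
  obtain ⟨m1, m2, m3, m4, m5, m6, m7⟩ := aMid_spec a
  rw [poleSet, mem_union, mem_Ico, mem_Ico] at hk
  rw [mem_Ico] at hk'
  unfold bMax at hk'
  have hlt : k < aMid a := by
    by_contra hge
    exact hk' ⟨not_lt.1 hge, lt_max_iff.2 (hk.elim (fun h => Or.inl h.2) fun h => Or.inr h.2)⟩
  -- `k` lies in exactly one pole block and below `â₁`
  have hcase : (k ∈ Ico (a 2) (b 2) ∧ k ∉ Ico (a 3) (b 3) ∨ k ∉ Ico (a 2) (b 2) ∧ k ∈ Ico (a 3) (b 3)) ∧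
      k ∈ Ico (b 1) (a 1) := by
    simp only [mem_Ico, not_and, not_lt]
    omega
  have h1 : multT a b k = 1 := by
    unfold multT
    rcases hcase.1 with ⟨c2, c3⟩ | ⟨c2, c3⟩
    · rw [if_pos c2, if_neg c3]
    · rw [if_neg c2, if_pos c3]
  rw [coefBT_of_simple h1, eval_numT_eq_zero_of_mem_block1 hcase.2, zero_div]

/-- The two Zudilin ranges lie in the pole set. [cite: Zudilin2014ZetaTwo, Section 6 (poles of R̂)] -/
theorem ranges_subset_poleSet (hab : AdmissibleT a b) :
    Ico (aMax3 a) (bMin b) ⊆ poleSet a b ∧ Ico (aMid a) (bMax b) ⊆ poleSet a b := by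
  have ha2 := hab.a_lt 2 (by decide)
  have ha3 := hab.a_lt 3 (by decide)
  have ha1 := hab.a_lt 1 (by decide)
  obtain ⟨m1, m2, m3, m4, m5, m6, m7⟩ := aMid_spec a
  constructor <;> intro k hk <;> rw [poleSet, mem_union, mem_Ico, mem_Ico] <;> rw [mem_Ico] at hk
  · unfold aMax3 bMin at hk; omega
  · unfold bMax at hk; omega

/-- **Partial fractions of `R̂` (Zudilin's ranges)**: for `t` off the poles,
`R̂(t) = Σ_{k=â₃*}^{b̂₂*−1} A_k/(t+k)² + Σ_{k=â₂*}^{b̂₃*−1} B_k/(t+k)`.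
[cite: Zudilin2014ZetaTwo, Section 6, display before eq. (T2)] -/
theorem RT_eq_polar (hab : AdmissibleT a b) {t : ℚ} (ht : (denT a b).eval t ≠ 0) :
    RT a b t = ∑ k ∈ Ico (aMax3 a) (bMin b), coefAT a b k / (t + k) ^ 2
      + ∑ k ∈ Ico (aMid a) (bMax b), coefBT a b k / (t + k) := by
  obtain ⟨hA, hB⟩ := ranges_subset_poleSet hab
  rw [RT_eq_polar_blocks hab ht, sum_add_distrib]
  congr 1
  · refine (sum_subset hA fun k hk hk' => ?_).symm
    rw [coefAT_eq_zero_of_not_mem hab hk hk', zero_div]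
  · refine (sum_subset hB fun k hk hk' => ?_).symm
    rw [coefBT_eq_zero_of_not_mem hab hk hk', zero_div]

/-! ### `Σ_k B_k = 0` (eq. (T4)) -/

/-- The `X^{deg denT − 1}`-coefficient of `polarNum_k` is `B_k`. [cite: Zudilin2014ZetaTwo, Section 6, eq. (T4)] -/
theorem coeff_polarNum (hab : AdmissibleT a b) {k : ℤ} (hk : k ∈ poleSet a b) :
    (polarNum a b k).coeff ((denT a b).natDegree - 1) = coefBT a b k := by
  have hμ := one_le_multT_of_mem hk
  have hμ2 := multT_le_two a b k
  have hd := natDegree_dhatT_add a b k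
  have hN := natDegree_numT_add_two hab
  unfold polarNum
  rw [add_mul, coeff_add, coeff_C_mul, mul_assoc, coeff_C_mul]
  have hq : ((X + C (k : ℚ)) ^ (multT a b k - 1) * dhatT a b k).Monic :=
    ((monic_X_add_C _).pow _).mul (monic_dhatT a b k)
  have hqdeg : ((X + C (k : ℚ)) ^ (multT a b k - 1) * dhatT a b k).natDegree = (denT a b).natDegree - 1 := by
    rw [((monic_X_add_C _).pow _).natDegree_mul (monic_dhatT a b k), (monic_X_add_C _).natDegree_pow,
      natDegree_X_add_C, mul_one]
    omega
  rw [← hqdeg, hq.coeff_natDegree, mul_one, hqdeg]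
  rcases (show multT a b k = 1 ∨ multT a b k = 2 by omega) with h1 | h2
  · rw [coefAT_of_simple h1, zero_mul, zero_add]
  · rw [coeff_eq_zero_of_natDegree_lt (by omega), mul_zero, zero_add]

/-- **Eq. (T4): `Σ_{k ∈ poles} B_k = 0`** (the coefficient of `X^{deg denT−1}` in `Ψ = 0`; analytically, the
residue of `R̂ = O(t⁻²)` at infinity). [cite: Zudilin2014ZetaTwo, Section 6, eq. (T4)] -/
theorem sum_coefBT_poleSet_eq_zero (hab : AdmissibleT a b) : ∑ k ∈ poleSet a b, coefBT a b k = 0 := by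
  have hΨ := psiPoly_eq_zero hab
  unfold psiPoly at hΨ
  rw [sub_eq_zero] at hΨ
  have hN := natDegree_numT_add_two hab
  have h := congrArg (fun f : ℚ[X] => f.coeff ((denT a b).natDegree - 1)) hΨ
  simp only [finsetSum_coeff] at h
  rw [coeff_eq_zero_of_natDegree_lt (by omega)] at h
  rw [sum_congr rfl fun k hk => (coeff_polarNum hab hk).symm]
  exact h.symm

/-- **Eq. (T4) on Zudilin's range: `Σ_{k=â₂*}^{b̂₃*−1} B_k = 0`.** [cite: Zudilin2014ZetaTwo, Section 6, eq. (T4)] -/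
theorem sum_coefBT_eq_zero (hab : AdmissibleT a b) : ∑ k ∈ Ico (aMid a) (bMax b), coefBT a b k = 0 := by
  rw [← sum_coefBT_poleSet_eq_zero hab]
  exact sum_subset (ranges_subset_poleSet hab).2 fun k hk hk' => coefBT_eq_zero_of_not_mem hab hk hk'

end Literature.NumberTheory.Irrationality.Zudilin2014

end

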